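import Summits.Parity.GeneralizedHardyLittlewood.Theorems.LeeYangFibresAbsoluteUpgradeModGammaAdjointEqKernel
import HarnessLib

/-!
# Route `LeeYangFibres`, crux `AbsoluteUpgrade` (stmt-Parity-14116), line `dip-margin-rate-exchange`:
# the adjoint method for `ModGammaDisc` — Laplace integrals and the explicit `v`-derivative
# (helper #2 for the stub `mg_adjointEq`)

Helper file for the registered stub `mg_adjointEq : MGEin → MGAdjointEq`.

* `AdjEq.hasDerivAt_integral_cexp_neg_mul` — differentiation of a Laplace-type integral
  `w ↦ ∫_0^∞ e^{-wx} K(x) dx` under the integral sign at `w = v > 0`, from a majorant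
  `(1+x)e^{-vx/2}‖K x‖ ≤ B x`, `B ∈ L¹(0,∞)` (Mathlib `hasDerivAt_integral_of_dominated_loc_of_deriv_le`;
  the template is the tree's `Literature.NumberTheory.Sieve.rosserAdjointP.hasDerivAt`);
* `mg_adjointEq_explicit` (registered helper) — STEP 1 of the adjoint equation: for `Re z ≥ -N + 1/2` and
  `v > 0`, `w ↦ w · adjTilde N z w` is differentiable at `v` with the EXPLICIT derivative
  `e^{γz}[Σ_{k<N} p_k(z)(z+1)⋯(z+k)(-(z+k))v^{-(z+k+1)} + Γ(1+z)⁻¹(I₀ - v I₁)]`,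
  `I_m = ∫_0^∞ x^m e^{-vx} x^{z+N} R_N(z,x) dx` (termwise differentiation of the power sum, and the kernel
  majorant of helper #1 for the remainder integral).

The identification of this explicit derivative with `-z · adjTilde N z (v+1)` is the business of the
next two helper files (integration by parts on `Re z > -1`, then analytic continuation in `z`).

References: [Greaves2001, §4.2.3]; tree `Literature/NumberTheory/Sieve/SieveAdjointP.lean`.
-/

noncomputable section

namespace Summit.Parity.GeneralizedHardyLittlewood.Cruxes.AbsoluteUpgrade.DipMarginRateExchange

open scoped BigOperators
open MeasureTheory Set Filter Topology
open Literature.NumberTheory.Sieve (ein einKernel)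

namespace AdjEq

/-! ## Laplace-type integrals: differentiation under the integral sign -/

/-- `‖e^{-wx}‖ = e^{-wx}` for real `w, x`. -/
theorem norm_cexp_neg_ofReal_mul (w x : ℝ) :
    ‖Complex.exp (-((w : ℂ) * x))‖ = Real.exp (-(w * x)) := by
  rw [show -((w : ℂ) * x) = ((-(w * x) : ℝ) : ℂ) by push_cast; ring, Complex.norm_exp_ofReal]

/-- The inclusion `ℝ → ℂ` has derivative `1`. -/
theorem hasDerivAt_ofReal (v : ℝ) : HasDerivAt (fun w : ℝ => (w : ℂ)) 1 v := by
  simpa using (hasDerivAt_id v).ofReal_comp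

/-- `d/dw e^{-wx} = -x e^{-wx}` (real `w`, complex values). -/
theorem hasDerivAt_cexp_neg_ofReal_mul (x w : ℝ) :
    HasDerivAt (fun w : ℝ => Complex.exp (-((w : ℂ) * x)))
      (-(x : ℂ) * Complex.exp (-((w : ℂ) * x))) w := by
  have h2 : HasDerivAt (fun w : ℝ => -((w : ℂ) * x)) (-(1 * (x : ℂ))) w :=
    ((hasDerivAt_ofReal w).mul_const (x : ℂ)).neg
  convert h2.cexp using 1
  ring

/-- `x^a e^{-bx}` is integrable on `(0, ∞)` for `a > -1`, `b > 0` (Mathlib's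
`integrableOn_rpow_mul_exp_neg_mul_rpow` with `p = 1`). -/
theorem integrableOn_rpow_mul_exp_neg_mul {a b : ℝ} (ha : -1 < a) (hb : 0 < b) :
    IntegrableOn (fun x : ℝ => x ^ a * Real.exp (-(b * x))) (Ioi 0) := by
  have h := integrableOn_rpow_mul_exp_neg_mul_rpow (p := 1) ha le_rfl hb
  refine h.congr_fun (fun x _ => ?_) measurableSet_Ioi
  simp only [Real.rpow_one, neg_mul]

/-- The standard majorant `C (1 + x) e^{-cx} (x^a + x^b)` is integrable on `(0, ∞)` (`a, b > -1`, `c >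
0`). -/
theorem integrableOn_majorant {c a b : ℝ} (C : ℝ) (hc : 0 < c) (ha : -1 < a) (hb : -1 < b) :
    IntegrableOn (fun x : ℝ => C * ((1 + x) * Real.exp (-(c * x)) * (x ^ a + x ^ b))) (Ioi 0) := by
  have h1 := integrableOn_rpow_mul_exp_neg_mul ha hc
  have h2 := integrableOn_rpow_mul_exp_neg_mul hb hc
  have h3 := integrableOn_rpow_mul_exp_neg_mul (by linarith : -1 < a + 1) hc
  have h4 := integrableOn_rpow_mul_exp_neg_mul (by linarith : -1 < b + 1) hc
  refine IntegrableOn.congr_fun (((h1.add h2).add (h3.add h4)).const_mul C)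
    (fun x (hx : 0 < x) => ?_) measurableSet_Ioi
  simp only [Pi.add_apply]
  rw [Real.rpow_add_one hx.ne', Real.rpow_add_one hx.ne']
  ring

/-- **Differentiation of a Laplace-type integral under the integral sign**: if `K` is continuous on `(0,
∞)` and `(1 + x) e^{-vx/2} ‖K x‖ ≤ B x` with `B` integrable, then `w ↦ ∫_0^∞ e^{-wx} K(x) dx` has
derivative `-∫_0^∞ x e^{-vx} K(x) dx` at `w = v > 0`
(`hasDerivAt_integral_of_dominated_loc_of_deriv_le` on the ball `|w - v| < v/2`). -/
theorem hasDerivAt_integral_cexp_neg_mul {K : ℝ → ℂ} (hK : ContinuousOn K (Ioi 0)) {v : ℝ}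
    (hv : 0 < v) {B : ℝ → ℝ} (hBi : IntegrableOn B (Ioi 0))
    (hB : ∀ x : ℝ, 0 < x → (1 + x) * Real.exp (-(v / 2 * x)) * ‖K x‖ ≤ B x) :
    HasDerivAt (fun w : ℝ => ∫ x in Ioi (0 : ℝ), Complex.exp (-((w : ℂ) * x)) * K x)
      (-∫ x in Ioi (0 : ℝ), (x : ℂ) * (Complex.exp (-((v : ℂ) * x)) * K x)) v := by
  set F : ℝ → ℝ → ℂ := fun w x => Complex.exp (-((w : ℂ) * x)) * K x with hF
  set F' : ℝ → ℝ → ℂ := fun w x => -((x : ℂ) * (Complex.exp (-((w : ℂ) * x)) * K x)) with hF'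
  have hε : 0 < v / 2 := half_pos hv
  have hball : Metric.ball v (v / 2) ∈ 𝓝 v := Metric.ball_mem_nhds v hε
  have hmem : ∀ w ∈ Metric.ball v (v / 2), v / 2 < w := fun w hw => by
    rw [Metric.mem_ball, Real.dist_eq] at hw; linarith [(abs_lt.mp hw).1]
  have hcontF : ∀ w, ContinuousOn (F w) (Ioi 0) := fun w =>
    (Continuous.continuousOn (by fun_prop)).mul hK
  have hcontF' : ∀ w, ContinuousOn (F' w) (Ioi 0) := fun w =>
    (Complex.continuous_ofReal.continuousOn.mul (hcontF w)).neg
  have key := hasDerivAt_integral_of_dominated_loc_of_deriv_le (μ := volume.restrict (Ioi (0:ℝ)))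
    (F := F) (F' := F') (x₀ := v) (bound := B) hball ?_ ?_ ?_ ?_ hBi ?_
  · have h2 := key.2
    rw [hF'] at h2
    rw [integral_neg] at h2
    exact h2
  · exact Eventually.of_forall fun w => (hcontF w).aestronglyMeasurable measurableSet_Ioi
  · refine Integrable.mono' hBi ((hcontF v).aestronglyMeasurable measurableSet_Ioi) ?_
    refine (ae_restrict_mem measurableSet_Ioi).mono fun x (hx : 0 < x) => ?_
    rw [hF]; dsimp only
    rw [norm_mul, norm_cexp_neg_ofReal_mul]
    refine le_trans ?_ (hB x hx)
    have h1 : Real.exp (-(v * x)) ≤ Real.exp (-(v / 2 * x)) := by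
      rw [Real.exp_le_exp]; nlinarith
    have h2 : Real.exp (-(v / 2 * x)) ≤ (1 + x) * Real.exp (-(v / 2 * x)) := by
      have := Real.exp_pos (-(v / 2 * x)); nlinarith
    exact mul_le_mul_of_nonneg_right (h1.trans h2) (norm_nonneg _)
  · exact (hcontF' v).aestronglyMeasurable measurableSet_Ioi
  · refine (ae_restrict_mem measurableSet_Ioi).mono fun x (hx : 0 < x) w hw => ?_
    rw [hF']; dsimp only
    rw [norm_neg, norm_mul, norm_mul, norm_cexp_neg_ofReal_mul, Complex.norm_real,
      Real.norm_of_nonneg hx.le]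
    refine le_trans ?_ (hB x hx)
    have hw' := hmem w hw
    have h1 : Real.exp (-(w * x)) ≤ Real.exp (-(v / 2 * x)) := by
      rw [Real.exp_le_exp]; nlinarith
    have hK0 := norm_nonneg (K x)
    have he := Real.exp_pos (-(v / 2 * x))
    calc x * (Real.exp (-(w * x)) * ‖K x‖) ≤ x * (Real.exp (-(v / 2 * x)) * ‖K x‖) := by gcongr
      _ ≤ (1 + x) * Real.exp (-(v / 2 * x)) * ‖K x‖ := by nlinarith
  · refine Eventually.of_forall fun x w _ => ?_
    refine ((hasDerivAt_cexp_neg_ofReal_mul x w).mul_const (K x)).congr_deriv ?_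
    rw [hF']; ring

/-- Three-factor form of `hasDerivAt_integral_cexp_neg_mul` (the syntactic shape of the integrals in
`adjTilde`). -/
theorem hasDerivAt_integral_cexp_neg_mul₃ {A R : ℝ → ℂ}
    (hK : ContinuousOn (fun x => A x * R x) (Ioi 0)) {v : ℝ}
    (hv : 0 < v) {B : ℝ → ℝ} (hBi : IntegrableOn B (Ioi 0))
    (hB : ∀ x : ℝ, 0 < x → (1 + x) * Real.exp (-(v / 2 * x)) * ‖A x * R x‖ ≤ B x) :
    HasDerivAt (fun w : ℝ => ∫ x in Ioi (0 : ℝ), Complex.exp (-((w : ℂ) * x)) * A x * R x)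
      (-∫ x in Ioi (0 : ℝ), (x : ℂ) * (Complex.exp (-((v : ℂ) * x)) * A x * R x)) v := by
  have h := hasDerivAt_integral_cexp_neg_mul hK hv hBi hB
  simpa only [mul_assoc] using h

/-- `d/dw (w : ℂ)^e = e w^{e-1}` for real `w ≠ 0` and every complex `e` (Mathlib's
`hasDerivAt_ofReal_cpow_const`, plus the trivial case `e = 0`). -/
theorem hasDerivAt_ofReal_cpow_const_of_ne {v : ℝ} (hv : v ≠ 0) (e : ℂ) :
    HasDerivAt (fun w : ℝ => (w : ℂ) ^ e) (e * (v : ℂ) ^ (e - 1)) v := by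
  rcases eq_or_ne e 0 with rfl | he
  · simp only [Complex.cpow_zero, zero_mul]; exact hasDerivAt_const v 1
  · exact hasDerivAt_ofReal_cpow_const hv he
/-! ## Step 1: the explicit derivative of `w ↦ w · adjTilde N z w` -/

/-- Continuity of `x ↦ (x : ℂ) ^ e` on `(0, ∞)`. -/
theorem continuousOn_ofReal_cpow (e : ℂ) : ContinuousOn (fun x : ℝ => (x : ℂ) ^ e) (Ioi 0) :=
  fun x hx => (Complex.continuousAt_ofReal_cpow_const x e (Or.inr (ne_of_gt hx))).continuousWithinAt

/-- Continuity of `x ↦ R_N(z, x)` on `(0, ∞)`. -/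
theorem continuousOn_remZ_ofReal (hE : MGEin) (N : ℕ) (z : ℂ) :
    ContinuousOn (fun x : ℝ => remZ N z x) (Ioi 0) := by
  intro x hx
  have hx0 : (x:ℂ) ≠ 0 := Complex.ofReal_ne_zero.mpr (ne_of_gt hx)
  have hc : ContinuousAt (fun y : ℂ => remZ N z y) (x : ℂ) := by
    unfold remZ
    refine ContinuousAt.div ?_ (by fun_prop) (pow_ne_zero _ hx0)
    exact ((continuous_phiZ hE z).sub (by fun_prop)).continuousAt
  exact (hc.comp Complex.continuous_ofReal.continuousAt).continuousWithinAt

/-- The regularised kernel `x ↦ x^{z+N} R_N(z,x)` is continuous on `(0, ∞)`. -/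
theorem continuousOn_cpow_mul_remZ (hE : MGEin) (N : ℕ) (z : ℂ) :
    ContinuousOn (fun x : ℝ => (x : ℂ) ^ (z + (N : ℂ)) * remZ N z x) (Ioi 0) := by
  intro x hx
  have hx' : 0 < x := hx
  have hx0 : (x:ℂ) ≠ 0 := Complex.ofReal_ne_zero.mpr hx'.ne'
  refine ContinuousAt.continuousWithinAt (ContinuousAt.mul ?_ ?_)
  · exact Complex.continuousAt_ofReal_cpow_const x _ (Or.inr hx'.ne')
  · have hc : ContinuousAt (fun y : ℂ => remZ N z y) (x : ℂ) := by
      unfold remZ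
      refine ContinuousAt.div ?_ (by fun_prop) (pow_ne_zero _ hx0)
      exact ((continuous_phiZ hE z).sub (by fun_prop)).continuousAt
    exact hc.comp Complex.continuous_ofReal.continuousAt

/-- **Step 1 of the adjoint equation: the explicit `w`-derivative of `w ↦ w · adjTilde N z w`** at `w =
v > 0`, valid for `Re z ≥ -N + 1/2`: the power sum is differentiated termwise (`w · w^{-(z+k+1)}`
has derivative `-(z+k) w^{-(z+k+1)}`) and the remainder integral under the integral sign (dominated
by the uniform majorant). -/
theorem hasDerivAt_mul_adjTilde_explicit (hE : MGEin) (N : ℕ) {z : ℂ}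
    (hz : -(N : ℝ) + 1 / 2 ≤ z.re) {v : ℝ} (hv : 0 < v) :
    HasDerivAt (fun w : ℝ => (w : ℂ) * adjTilde N z w)
      (Complex.exp ((Real.eulerMascheroniConstant : ℂ) * z) *
        ((∑ k ∈ Finset.range N, pCoeff z k * (∏ i ∈ Finset.range k, (z + ((i : ℂ) + 1))) *
            (-(z + (k : ℂ)) * (v : ℂ) ^ (-(z + ((k : ℂ) + 1))))) +
          (Complex.Gamma (1 + z))⁻¹ *
            ((∫ x in Ioi (0 : ℝ), Complex.exp (-((v : ℂ) * x)) * ((x : ℂ) ^ (z + (N : ℂ))) *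
                remZ N z x) -
              (v : ℂ) * ∫ x in Ioi (0 : ℝ), (x : ℂ) *
                (Complex.exp (-((v : ℂ) * x)) * ((x : ℂ) ^ (z + (N : ℂ))) * remZ N z x)))) v := by
  have hv0 : (v : ℂ) ≠ 0 := Complex.ofReal_ne_zero.mpr hv.ne'
  -- the majorant
  obtain ⟨C, -, hC⟩ := norm_cpow_mul_remZ_le hE N (Λ := ‖z‖) (σ := -(N:ℝ) + 1 / 2)
    (norm_nonneg z) (by linarith)
  have hI := hasDerivAt_integral_cexp_neg_mul₃ (A := fun x : ℝ => (x : ℂ) ^ (z + (N : ℂ)))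
    (R := fun x : ℝ => remZ N z x) (continuousOn_cpow_mul_remZ hE N z) hv
    (integrableOn_majorant (a := -(N:ℝ) + 1 / 2 + N) (b := 2 * ‖z‖ + 2 * N) C (half_pos hv)
      (by norm_num) (by linarith [norm_nonneg z, (Nat.cast_nonneg N : (0:ℝ) ≤ N)])) (fun x hx => by
      have h1 : 0 ≤ (1 + x) * Real.exp (-(v / 2 * x)) := by positivity
      calc (1 + x) * Real.exp (-(v / 2 * x)) * ‖(x : ℂ) ^ (z + (N : ℂ)) * remZ N z x‖
          ≤ (1 + x) * Real.exp (-(v / 2 * x)) *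
              (C * (x ^ (-(N:ℝ) + 1 / 2 + N) + x ^ (2 * ‖z‖ + 2 * N))) :=
            mul_le_mul_of_nonneg_left (hC z le_rfl hz x hx) h1
        _ = C * ((1 + x) * Real.exp (-(v / 2 * x)) *
              (x ^ (-(N:ℝ) + 1 / 2 + N) + x ^ (2 * ‖z‖ + 2 * N))) := by ring)
  -- the finite sum
  have hS : HasDerivAt (fun w : ℝ => ∑ k ∈ Finset.range N,
      pCoeff z k * (∏ i ∈ Finset.range k, (z + ((i : ℂ) + 1))) * (w : ℂ) ^ (-(z + ((k : ℂ) + 1))))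
      (∑ k ∈ Finset.range N, pCoeff z k * (∏ i ∈ Finset.range k, (z + ((i : ℂ) + 1))) *
        ((-(z + ((k : ℂ) + 1))) * (v : ℂ) ^ (-(z + ((k : ℂ) + 1)) - 1))) v :=
    HasDerivAt.fun_sum fun k _ => (hasDerivAt_ofReal_cpow_const_of_ne hv.ne' _).const_mul _
  have hprod := (hasDerivAt_ofReal v).fun_mul
    ((hS.fun_add (hI.const_mul ((Complex.Gamma (1 + z))⁻¹))).const_mul
      (Complex.exp ((Real.eulerMascheroniConstant : ℂ) * z)))
  have hterm : ∀ k ∈ Finset.range N,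
      pCoeff z k * (∏ i ∈ Finset.range k, (z + ((i : ℂ) + 1))) * (v : ℂ) ^ (-(z + ((k : ℂ) + 1))) +
        (v : ℂ) * (pCoeff z k * (∏ i ∈ Finset.range k, (z + ((i : ℂ) + 1))) *
          ((-(z + ((k : ℂ) + 1))) * (v : ℂ) ^ (-(z + ((k : ℂ) + 1)) - 1))) =
      pCoeff z k * (∏ i ∈ Finset.range k, (z + ((i : ℂ) + 1))) *
        (-(z + (k : ℂ)) * (v : ℂ) ^ (-(z + ((k : ℂ) + 1)))) := by
    intro k _
    have h1 : (v : ℂ) * (v : ℂ) ^ (-(z + ((k : ℂ) + 1)) - 1) = (v : ℂ) ^ (-(z + ((k : ℂ) + 1))) := by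
      rw [Complex.cpow_sub _ _ hv0, Complex.cpow_one, mul_div_cancel₀ _ hv0]
    linear_combination (pCoeff z k * (∏ i ∈ Finset.range k, (z + ((i : ℂ) + 1))) *
      (-(z + ((k : ℂ) + 1)))) * h1
  have hsum : ∑ k ∈ Finset.range N, pCoeff z k * (∏ i ∈ Finset.range k, (z + ((i : ℂ) + 1))) *
        (-(z + (k : ℂ)) * (v : ℂ) ^ (-(z + ((k : ℂ) + 1)))) =
      (∑ k ∈ Finset.range N,
        pCoeff z k * (∏ i ∈ Finset.range k, (z + ((i : ℂ) + 1))) * (v : ℂ) ^ (-(z + ((k : ℂ) + 1)))) +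
      (v : ℂ) * ∑ k ∈ Finset.range N, pCoeff z k * (∏ i ∈ Finset.range k, (z + ((i : ℂ) + 1))) *
        ((-(z + ((k : ℂ) + 1))) * (v : ℂ) ^ (-(z + ((k : ℂ) + 1)) - 1)) := by
    rw [Finset.mul_sum, ← Finset.sum_add_distrib]
    exact Finset.sum_congr rfl fun k hk => (hterm k hk).symm
  refine hprod.congr_deriv ?_
  rw [hsum]
  ring

end AdjEq

/-- **Step 1 of the adjoint equation: the explicit `w`-derivative of `w ↦ w · adjTilde N z w`** at
`w = v > 0` for `Re z ≥ -N + 1/2` (registered helper for the stub `mg_adjointEq`, line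
`dip-margin-rate-exchange`). -/
theorem mg_adjointEq_explicit : MGEin → ∀ N : ℕ, ∀ z : ℂ, -(N : ℝ) + 1 / 2 ≤ z.re → ∀ v : ℝ, 0 < v → HasDerivAt (fun w : ℝ => (w : ℂ) * adjTilde N z w) (Complex.exp ((Real.eulerMascheroniConstant : ℂ) * z) * ((∑ k ∈ Finset.range N, pCoeff z k * (∏ i ∈ Finset.range k, (z + ((i : ℂ) + 1))) * (-(z + (k : ℂ)) * (v : ℂ) ^ (-(z + ((k : ℂ) + 1))))) + (Complex.Gamma (1 + z))⁻¹ * ((∫ x in Ioi (0 : ℝ), Complex.exp (-((v : ℂ) * x)) * ((x : ℂ) ^ (z + (N : ℂ))) * remZ N z x) - (v : ℂ) * ∫ x in Ioi (0 : ℝ), (x : ℂ) * (Complex.exp (-((v : ℂ) * x)) * ((x : ℂ) ^ (z + (N : ℂ))) * remZ N z x)))) v :=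
  fun hE N _ hz _ hv => AdjEq.hasDerivAt_mul_adjTilde_explicit hE N hz hv

end Summit.Parity.GeneralizedHardyLittlewood.Cruxes.AbsoluteUpgrade.DipMarginRateExchange

end
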